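import Summits.QuantumFields.YangMills.Theses.FradkinShenkerFlow
import Literature.MathematicalPhysics.QuantumFieldTheory.LatticeGaugeStaticPotentialProofs
import Literature.MathematicalPhysics.QuantumFieldTheory.LatticeGaugeProofs

/-!
# Candidate proof of STUB 4 `stub_axisIsotropy` (line `sup-axis-reflection-transfer`, crux stmt-QuantumFields-9442)

Axis permutations act on species (`permSpecies`: cylinder by `IsCylinder.comp_configPermZd`, gauge invariant by
`configPermZd_gaugeTransformZd`, bounded, measurable), the periodic lift intertwines
(`toTorusObservable_comp_configPermZd`), `configPermZd π ∘ configShift v = configShift (sitePermZd π v) ∘ configPermZd π`,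
and the torus Wilson state is `configPerm`-invariant (`wilsonMeasure_map_configPerm`, needs only continuity of `r.ρ`):
every axis-`μ` covariance of `(A, B)` is an axis-`0` covariance of the `swap 0 μ`-permuted pair, term by term.
drefute seat refuter-drefute-stmt-QuantumFields-9442-0 (positive by-product, attached as item evidence; a prover lands it).
-/

noncomputable section

open MeasureTheory ProbabilityTheory
open scoped BigOperators
open Literature.MathematicalPhysics.QuantumFieldTheory hiding Site ZdEdge
open Literature.MathematicalPhysics.QuantumLattice

namespace Summit.QuantumFields.YangMills.Cruxes.FiniteSusceptibilityWeakCoupling.SupAxisReflectionTransfer.AxisIsotropyProof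

section Perm

variable {G : Type} [Group G] [MeasurableSpace G]

/-- Axis permutations intertwine gauge transformations: `π_* (U^g) = (π_* U)^{g ∘ π⁻¹}`. [folklore] -/
theorem configPermZd_gaugeTransformZd (π : Equiv.Perm (Fin 4))
    (g : Literature.Probability.LatticeModels.Site 4 → G) (U : LGConfig 4 G) :
    configPermZd π (gaugeTransformZd g U) =
      gaugeTransformZd (g ∘ sitePermZd π.symm) (configPermZd π U) := by
  funext e
  simp only [configPermZd_apply, gaugeTransformZd, Function.comp_apply, sitePermZd_add,
    sitePermZd_single]

omit [Group G] in
/-- Axis permutations conjugate translations: `π_* ∘ τ_v = τ_{π v} ∘ π_*`. [folklore] -/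
theorem configPermZd_configShift (π : Equiv.Perm (Fin 4))
    (v : Literature.Probability.LatticeModels.Site 4) (W : LGConfig 4 G) :
    configPermZd π (configShift v W) = configShift (sitePermZd π v) (configPermZd π W) := by
  funext e
  simp only [configPermZd_apply, configShift_apply]
  congr 2
  ext j
  simp [sitePermZd_apply]

omit [Group G] in
/-- The periodic lift intertwines the axis permutations of `ℤ⁴` and of the torus. [folklore] -/
theorem configPermZd_torusLift (L : ℕ) (π : Equiv.Perm (Fin 4)) (U : GaugeConfig 4 L G) :
    configPermZd π (torusLift L U) = torusLift L (configPerm π U) :=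
  congrFun (toTorusObservable_comp_configPermZd (G := G) L π (id : LGConfig 4 G → LGConfig 4 G)) U

/-- The axis-permuted species `A ∘ π_*`. [folklore] -/
def permSpecies (π : Equiv.Perm (Fin 4)) (A : YMSpecies G) : YMSpecies G where
  F := A.F ∘ configPermZd π
  supp := A.supp.image fun e => (sitePermZd π.symm e.1, π.symm e.2)
  isCylinder := Literature.MathematicalPhysics.QuantumFieldTheory.IsCylinder.comp_configPermZd A.isCylinder π
  gaugeInvariant := fun g U => by
    simp only [Function.comp_apply, configPermZd_gaugeTransformZd]
    exact A.gaugeInvariant _ _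
  bounded := by
    obtain ⟨C, hC⟩ := A.bounded
    exact ⟨C, fun U => hC _⟩
  measurable := A.measurable.comp (configPermZd π).measurable

@[simp] theorem permSpecies_F (π : Equiv.Perm (Fin 4)) (A : YMSpecies G) (W : LGConfig 4 G) :
    (permSpecies π A).F W = A.F (configPermZd π W) := rfl

end Perm

/-- **STUB 4 (`AxisIsotropy`), verbatim statement of the registered `stub_axisIsotropy`.** [folklore] -/
theorem axisIsotropy : ∀ (G : Type) [Group G] [TopologicalSpace G] [IsTopologicalGroup G] [CompactSpace G] [MeasurableSpace G] [BorelSpace G] (r : Literature.MathematicalPhysics.QuantumFieldTheory.LatticeRep G) (β : ℝ), (∀ A B : Literature.MathematicalPhysics.QuantumFieldTheory.YMSpecies G, ∃ M : ℝ, ∀ S : ℕ, ∑ n ∈ Finset.range (S + 1), ((n : ℝ) + 1) ^ 3 * |ProbabilityTheory.covariance (fun U => A.F (Literature.MathematicalPhysics.QuantumLattice.torusLift (2 * S + 1) U)) (fun U => B.F (Literature.MathematicalPhysics.QuantumLattice.configShift (-(Pi.single 0 (n : ℤ))) (Literature.MathematicalPhysics.QuantumLattice.torusLift (2 * S + 1)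 U))) (Literature.MathematicalPhysics.QuantumFieldTheory.wilsonMeasure (d := 4) (L := 2 * S + 1) r.ρ β)| ≤ M) → ∀ (μ : Fin 4) (A B : Literature.MathematicalPhysics.QuantumFieldTheory.YMSpecies G), ∃ M : ℝ, ∀ S : ℕ, ∑ n ∈ Finset.range (S + 1), ((n : ℝ) + 1) ^ 3 * |ProbabilityTheory.covariance (fun U => A.F (Literature.MathematicalPhysics.QuantumLattice.torusLift (2 * S + 1) U)) (fun U => B.F (Literature.MathematicalPhysics.QuantumLattice.configShift (-(Pi.single μ (n : ℤ))) (Literature.MathematicalPhysics.QuantumLattice.torusLift (2 * S + 1) U))) (Literature.MathematicalPhysics.QuantumFieldTheory.wilsonMeasure (d := 4) (L := 2 * S + 1) r.ρ β)| ≤ M := by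
  intro G _ _ _ _ _ _ r β hyp μ A B
  set σ : Equiv.Perm (Fin 4) := Equiv.swap 0 μ with hσ
  have hσ0 : σ 0 = μ := by rw [hσ, Equiv.swap_apply_left]
  obtain ⟨M, hM⟩ := hyp (permSpecies σ A) (permSpecies σ B)
  refine ⟨M, fun S => ?_⟩
  have hterm : ∀ n : ℕ,
      cov[fun U => A.F (torusLift (2 * S + 1) U),
          fun U => B.F (configShift (-(Pi.single μ (n : ℤ))) (torusLift (2 * S + 1) U));
          wilsonMeasure (d := 4) (L := 2 * S + 1) r.ρ β] =
      cov[fun U => (permSpecies σ A).F (torusLift (2 * S + 1) U),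
          fun U => (permSpecies σ B).F (configShift (-(Pi.single 0 (n : ℤ))) (torusLift (2 * S + 1) U));
          wilsonMeasure (d := 4) (L := 2 * S + 1) r.ρ β] := by
    intro n
    have hv : sitePermZd σ (-(Pi.single 0 (n : ℤ)) : Literature.Probability.LatticeModels.Site 4) =
        -(Pi.single μ (n : ℤ)) := by
      have h := sitePermZd_single σ 0 (n : ℤ)
      rw [hσ0] at h
      ext j
      have hj := congrFun h j
      simp only [sitePermZd_apply, Pi.neg_apply] at hj ⊢
      rw [hj]
    have h1 : (fun U : GaugeConfig 4 (2 * S + 1) G => (permSpecies σ A).F (torusLift (2 * S + 1) U)) =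
        (fun U => A.F (torusLift (2 * S + 1) U)) ∘ (configPerm σ) := by
      funext U
      simp only [permSpecies_F, Function.comp_apply, configPermZd_torusLift]
    have h2 : (fun U : GaugeConfig 4 (2 * S + 1) G =>
          (permSpecies σ B).F (configShift (-(Pi.single 0 (n : ℤ))) (torusLift (2 * S + 1) U))) =
        (fun U => B.F (configShift (-(Pi.single μ (n : ℤ))) (torusLift (2 * S + 1) U))) ∘ (configPerm σ) := by
      funext U
      simp only [permSpecies_F, Function.comp_apply, configPermZd_configShift, configPermZd_torusLift, hv]
    rw [h1, h2, ← covariance_map_equiv, wilsonMeasure_map_configPerm r.ρ r.continuous β σ]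
  simp_rw [hterm]
  exact hM S

end Summit.QuantumFields.YangMills.Cruxes.FiniteSusceptibilityWeakCoupling.SupAxisReflectionTransfer.AxisIsotropyProof

end
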